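import Summits.QuantumFields.YangMills.Theses.ConvexGribovBody
import Literature.MathematicalPhysics.QuantumLattice.GaugeGroups
import HarnessLib

/-!
# Crux `NonSimplyConnectedLatticeGap` (stmt-QuantumFields-16405), route `ConvexGribovBody`, line
# `twist-equipartition-blindness` — stub COVER reduced to Weyl's covering theorem

Stub COVER (`stub_universalCover`) of the skeleton line `twist-equipartition-blindness`: every compact
simple Lie group `G` in the crux's sense (`IsCompactSimpleLieGroup G`: connected, non-abelian, every closed
preconnected normal subgroup `⊥` or `⊤`, a faithful continuous unitary matrix representation) that is NOT
simply connected has a compact simply connected `H`, again `IsCompactSimpleLieGroup`, and a continuous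
surjective homomorphism `π : H →* G` with central, finite, non-trivial kernel.

This file separates the TOPOLOGICAL-GROUP part of COVER, proved here, from its LIE-THEORETIC part, which is
the published theorem (absent from Mathlib and from the tree) taken VERBATIM as the hypothesis of
`stub_universalCover_of_cover`:

> (W) *the universal covering group of a compact connected semisimple Lie group is compact and linear* —
> for a compact connected topological group `G` with a faithful continuous unitary matrix representation
> (a compact connected Lie group, Bröcker–tom Dieck III (4.1) with I (3.11)) which is semisimple
> (Bröcker–tom Dieck V (3.13)–(3.14): no (closed) connected abelian normal subgroup other than `{1}`,
> equivalently finite centre) there are a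
> compact simply connected topological group `H` with a faithful continuous unitary matrix representation
> and a continuous surjective homomorphism `π : H →* G` with finite kernel (Sepanski 2007 Thm. 1.22: the
> simply connected covering group; Bröcker–tom Dieck V (7.1) with Remark (7.13), Sepanski Cor. 6.33(a):
> `π₁(G) ≅ ker π ≅ I/Γ` is finite, i.e. `H` is compact; Bröcker–tom Dieck III (4.1): `H` is linear).

Proved here (general lemmas, prefixed `coverAux_`):

* `coverAux_subset_singleton_of_finite` — in a `T₁` space a preconnected subset of a finite set is a
  point;
* `coverAux_le_center_of_finite` — a finite normal subgroup of a connected `T₁` group is central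
  (Sepanski Lemma 1.21: the conjugation orbit of each element is connected and finite);
* `coverAux_normalClause_of_finite_ker` — the simplicity clause LIFTS along a continuous surjective
  homomorphism `π : H →* G` with finite kernel from `G` to a compact connected `H`: the image of a closed
  preconnected normal `N ⊴ H` is `⊥` (then `N ⊆ ker π` is a point) or `⊤` (then the finitely many closed
  cosets `N·k`, `k ∈ ker π`, cover `H`, so `N` is clopen, `N = H`);
* `coverAux_ker_ne_bot` — a continuous bijective homomorphism from a compact simply connected group onto a
  Hausdorff group is a homeomorphism, so its target is simply connected;
* `stub_universalCover_of_cover` — **(W) ⇒ COVER** (registered side-stub): semisimplicity of `G` from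
  the simplicity clause and non-commutativity; Hausdorffness of `G`, `H` from the faithful representations;
  connectedness of `H` from simple connectivity; the clause for `H`, centrality and non-triviality of
  `ker π` from the lemmas above; Borel σ-algebra on `H`.

No definition is introduced and no named unproved fact is used: (W) is a hypothesis, to be filed as a
Literature statement by the route's lead (it is NOT the stub in costume: its hypotheses and conclusion are
the textbook ones, over Mathlib vocabulary only).
-/

set_option autoImplicit false

noncomputable section

namespace Summit.QuantumFields.YangMills.Theorems.NonSimplyConnectedLatticeGap

open Literature.MathematicalPhysics.QuantumFieldTheory Literature.MathematicalPhysics.QuantumLattice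
open Topology

/-- **In a `T₁` space, a preconnected subset of a finite set is a point**: if `s ⊆ t`, `t` finite, `s`
preconnected and `x ∈ s`, then `s ⊆ {x}` (`{x}` and `s ∖ {x}` are disjoint closed sets covering `s`).
[folklore] -/
theorem coverAux_subset_singleton_of_finite {X : Type*} [TopologicalSpace X] [T1Space X] {s t : Set X}
    (hs : IsPreconnected s) (ht : t.Finite) (hst : s ⊆ t) {x : X} (hx : x ∈ s) : s ⊆ {x} := by
  have hv : IsClosed (s \ {x}) := (ht.subset fun y hy => hst hy.1).isClosed
  have hcov : s ⊆ {x} ∪ (s \ {x}) := by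
    intro y hy
    by_cases h : y = x
    · exact Or.inl h
    · exact Or.inr ⟨hy, h⟩
  have hdisj : s ∩ ({x} ∩ (s \ {x})) = ∅ := by
    rw [Set.eq_empty_iff_forall_notMem]
    rintro y ⟨-, hy1, -, hy2⟩
    exact hy2 hy1
  rcases (isPreconnected_iff_subset_of_disjoint_closed.1 hs) {x} (s \ {x}) isClosed_singleton hv hcov hdisj
    with h | h
  · exact h
  · exact ((h hx).2 (Set.mem_singleton x)).elim

/-- **A finite normal subgroup of a connected `T₁` topological group is central** (Sepanski 2007,
Lemma 1.21, there for discrete normal subgroups of connected Lie groups): the conjugation orbit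
`{h k h⁻¹}` of `k ∈ K` is a connected subset of the finite `K` containing `k`, hence `{k}`.
[cite: Sepanski2007, Lemma 1.21] -/
theorem coverAux_le_center_of_finite {H : Type*} [Group H] [TopologicalSpace H] [IsTopologicalGroup H]
    [ConnectedSpace H] [T1Space H] (K : Subgroup H) [hK : K.Normal] (hfin : (K : Set H).Finite) :
    K ≤ Subgroup.center H := by
  intro k hk
  rw [Subgroup.mem_center_iff]
  intro g
  have hcont : Continuous fun h : H => h * k * h⁻¹ := by fun_prop
  have hrange : Set.range (fun h : H => h * k * h⁻¹) ⊆ {k} :=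
    coverAux_subset_singleton_of_finite (isPreconnected_range hcont) hfin
      (by
        rintro _ ⟨h, rfl⟩
        exact hK.conj_mem k hk h)
      ⟨1, by simp⟩
  have hg : g * k * g⁻¹ = k := hrange ⟨g, rfl⟩
  calc g * k = g * k * g⁻¹ * g := by group
    _ = k * g := by rw [hg]

/-- **The simplicity clause lifts along a finite-kernel cover.** Let `π : H →* G` be a continuous
surjective homomorphism with finite kernel from a compact connected `T₁` group `H` onto a Hausdorff group
`G` in which every closed preconnected normal subgroup is `⊥` or `⊤`. Then the same holds in `H`: for a
closed preconnected normal `N ⊴ H`, `π(N)` is a closed (compact) preconnected normal subgroup of `G`; if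
`π(N) = ⊥` then `N ⊆ ker π` is a preconnected subset of a finite set containing `1`, so `N = ⊥`; if
`π(N) = ⊤` then `H = ⋃_{k ∈ ker π} N·k`, the complement of `N` is the finite union of the closed cosets
`N·k`, `k ∈ ker π ∖ N`, so `N` is clopen and `N = H` by connectedness. [folklore] -/
theorem coverAux_normalClause_of_finite_ker {G H : Type*} [Group G] [TopologicalSpace G] [T2Space G]
    [Group H] [TopologicalSpace H] [IsTopologicalGroup H] [CompactSpace H] [ConnectedSpace H] [T1Space H]
    (π : H →* G) (hπc : Continuous π) (hπs : Function.Surjective π) (hfin : (π.ker : Set H).Finite)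
    (hG : ∀ N : Subgroup G, N.Normal → IsClosed (N : Set G) → IsPreconnected (N : Set G) → N = ⊥ ∨ N = ⊤) :
    ∀ N : Subgroup H, N.Normal → IsClosed (N : Set H) → IsPreconnected (N : Set H) → N = ⊥ ∨ N = ⊤ := by
  intro N hN hc hp
  have hmapN : (N.map π).Normal := hN.map π hπs
  have hmapc : IsClosed ((N.map π : Subgroup G) : Set G) := by
    rw [Subgroup.coe_map]
    exact (hc.isCompact.image hπc).isClosed
  have hmapp : IsPreconnected ((N.map π : Subgroup G) : Set G) := by
    rw [Subgroup.coe_map]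
    exact hp.image π hπc.continuousOn
  rcases hG (N.map π) hmapN hmapc hmapp with hbot | htop
  · -- `N ⊆ ker π` is a preconnected subset of a finite set containing `1`
    left
    have hle : (N : Set H) ⊆ (π.ker : Set H) := by
      intro n hn
      rw [SetLike.mem_coe, MonoidHom.mem_ker]
      have hmem : π n ∈ N.map π := Subgroup.mem_map_of_mem π hn
      rwa [hbot, Subgroup.mem_bot] at hmem
    have hsub : (N : Set H) ⊆ {1} := coverAux_subset_singleton_of_finite hp hfin hle N.one_mem
    rw [Subgroup.eq_bot_iff_forall]
    intro n hn
    exact hsub hn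
  · -- `π(N) = G`: the closed cosets `N·k`, `k ∈ ker π`, cover `H`, so `N` is clopen
    right
    have hcover : ∀ h : H, ∃ n ∈ N, n⁻¹ * h ∈ π.ker := by
      intro h
      have hh : π h ∈ N.map π := by
        rw [htop]
        exact Subgroup.mem_top _
      obtain ⟨n, hn, hnh⟩ := Subgroup.mem_map.1 hh
      refine ⟨n, hn, ?_⟩
      rw [MonoidHom.mem_ker, map_mul, map_inv, hnh, inv_mul_cancel]
    have hSfin : {k : H | k ∈ π.ker ∧ k ∉ N}.Finite := hfin.subset fun k hk => hk.1
    have hU : IsClosed (⋃ k ∈ {k : H | k ∈ π.ker ∧ k ∉ N}, (Homeomorph.mulRight k) '' (N : Set H)) :=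
      hSfin.isClosed_biUnion fun k _ => (Homeomorph.mulRight k).isClosedMap _ hc
    have hcompl : (N : Set H)ᶜ = ⋃ k ∈ {k : H | k ∈ π.ker ∧ k ∉ N}, (Homeomorph.mulRight k) '' (N : Set H) := by
      ext h
      simp only [Set.mem_compl_iff, SetLike.mem_coe, Set.mem_iUnion, Set.mem_image, Homeomorph.coe_mulRight,
        Set.mem_setOf_eq, exists_prop]
      constructor
      · intro hh
        obtain ⟨n, hn, hk⟩ := hcover h
        refine ⟨n⁻¹ * h, ⟨hk, fun hmem => hh ?_⟩, n, hn, mul_inv_cancel_left n h⟩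
        simpa using N.mul_mem hn hmem
      · rintro ⟨k, ⟨-, hkN⟩, n, hn, rfl⟩ hmem
        exact hkN (by simpa using N.mul_mem (N.inv_mem hn) hmem)
    have hopen : IsOpen (N : Set H) := by
      rw [← isClosed_compl_iff, hcompl]
      exact hU
    have huniv : (N : Set H) = Set.univ := IsClopen.eq_univ ⟨hc, hopen⟩ ⟨1, N.one_mem⟩
    exact Subgroup.coe_eq_univ.1 huniv

/-- **A finite-kernel cover of a non-simply-connected group by a simply connected compact group has
non-trivial kernel**: otherwise `π` is a continuous bijection from a compact space onto a Hausdorff space,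
hence a homeomorphism, and simple connectivity is a homotopy invariant. [folklore] -/
theorem coverAux_ker_ne_bot {G H : Type*} [Group G] [TopologicalSpace G] [T2Space G] [Group H]
    [TopologicalSpace H] [CompactSpace H] (π : H →* G) (hπc : Continuous π) (hπs : Function.Surjective π)
    (hsc : SimplyConnectedSpace H) (hnsc : ¬ SimplyConnectedSpace G) : π.ker ≠ ⊥ := by
  intro hbot
  have hinj : Function.Injective π := (MonoidHom.ker_eq_bot_iff π).1 hbot
  have e : H ≃ₜ G := Continuous.homeoOfEquivCompactToT2 (f := Equiv.ofBijective π ⟨hinj, hπs⟩) hπc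
  exact hnsc (e.toHomotopyEquiv.simplyConnectedSpace_iff.1 hsc)

/-- **STUB COVER from Weyl's covering theorem (W) — registered side-stub `stub_universalCover_of_cover`.**
Hypothesis (verbatim, to be filed as a Literature statement): for every compact connected topological
group `G` with a faithful continuous unitary matrix representation in which every closed preconnected
abelian normal subgroup is trivial (semisimple, Bröcker–tom Dieck V (3.13)), there are a compact simply
connected `H` with a faithful continuous unitary matrix representation and a continuous surjective
homomorphism `π : H →* G` with finite kernel (Sepanski Thm. 1.22 + Cor. 6.33(a); Bröcker–tom Dieck V (7.1),
Remark (7.13), III (4.1)). Conclusion: the registered signature of `stub_universalCover`. Proof: `G` is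
semisimple in that sense (a closed preconnected abelian normal subgroup is `⊥` or `⊤` by the simplicity
clause, and `⊤` would make `G` abelian); `G` and `H` are Hausdorff (faithful continuous representations
into matrices); `H` is connected (simply connected ⇒ path connected), non-abelian (it maps onto the
non-abelian `G`), satisfies the simplicity clause (`coverAux_normalClause_of_finite_ker`), `ker π` is
central (`coverAux_le_center_of_finite`) and non-trivial (`coverAux_ker_ne_bot`); Borel σ-algebra.
[cite: BrockerTomDieck1985, V (7.1) and Remark (7.13)] [cite: Sepanski2007, Thm. 1.22 and Cor. 6.33] -/
theorem stub_universalCover_of_cover :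
    (∀ (G : Type) [Group G] [TopologicalSpace G] [IsTopologicalGroup G] [CompactSpace G] [ConnectedSpace G]
      (N : ℕ) (ρ : G →* Matrix (Fin N) (Fin N) ℂ), Continuous ρ → Function.Injective ρ →
      (∀ g, ρ g ∈ Matrix.unitaryGroup (Fin N) ℂ) →
      (∀ A : Subgroup G, A.Normal → IsClosed (A : Set G) → IsPreconnected (A : Set G) →
        (∀ a ∈ A, ∀ b ∈ A, a * b = b * a) → A = ⊥) →
      ∃ (H : Type) (_ : Group H) (_ : TopologicalSpace H) (_ : IsTopologicalGroup H) (_ : CompactSpace H)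
        (π : H →* G), SimplyConnectedSpace H ∧ Continuous π ∧ Function.Surjective π ∧
        (π.ker : Set H).Finite ∧ ∃ (M : ℕ) (σ : H →* Matrix (Fin M) (Fin M) ℂ), Continuous σ ∧
        Function.Injective σ ∧ ∀ h, σ h ∈ Matrix.unitaryGroup (Fin M) ℂ) →
    ∀ (G : Type) [Group G] [TopologicalSpace G] [IsTopologicalGroup G] [CompactSpace G],
    Literature.MathematicalPhysics.QuantumFieldTheory.IsCompactSimpleLieGroup G → ¬ SimplyConnectedSpace G → ∃ (H :
    Type) (_ : Group H) (_ : TopologicalSpace H) (_ : IsTopologicalGroup H) (_ : CompactSpace H) (_ : MeasurableSpace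
    H) (_ : BorelSpace H) (π : H →* G), Literature.MathematicalPhysics.QuantumFieldTheory.IsCompactSimpleLieGroup H ∧
    SimplyConnectedSpace H ∧ Continuous π ∧ Function.Surjective π ∧ π.ker ≤ Subgroup.center H ∧ (π.ker : Set H).Finite
    ∧ π.ker ≠ ⊥ := by
  intro hcov G _ _ _ _ hG hnsc
  obtain ⟨⟨hconn, ⟨a, b, hab⟩, hclause⟩, ⟨r⟩⟩ := hG
  haveI : ConnectedSpace G := hconn
  haveI : T2Space G := (r.continuous.isClosedEmbedding r.injective).isEmbedding.t2Space
  -- `G` is semisimple in the sense of Bröcker–tom Dieck V (3.13)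
  have hss : ∀ A : Subgroup G, A.Normal → IsClosed (A : Set G) → IsPreconnected (A : Set G) →
      (∀ a ∈ A, ∀ b ∈ A, a * b = b * a) → A = ⊥ := by
    intro A hA hc hp hcomm
    rcases hclause A hA hc hp with h | h
    · exact h
    · exfalso
      apply hab
      rw [h] at hcomm
      exact hcomm a (Subgroup.mem_top a) b (Subgroup.mem_top b)
  obtain ⟨H, _, _, _, _, π, hsc, hπc, hπs, hfin, M, σ, hσc, hσi, hσu⟩ :=
    hcov G r.N r.ρ r.continuous r.injective r.mem_unitary hss
  haveI : T2Space H := (hσc.isClosedEmbedding hσi).isEmbedding.t2Space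
  haveI : SimplyConnectedSpace H := hsc
  letI : MeasurableSpace H := borel H
  haveI : BorelSpace H := ⟨rfl⟩
  have hH : IsCompactSimpleLieGroup H := by
    refine ⟨⟨inferInstance, ?_, ?_⟩, ⟨⟨M, σ, hσc, hσi, hσu⟩⟩⟩
    · obtain ⟨a', ha'⟩ := hπs a
      obtain ⟨b', hb'⟩ := hπs b
      refine ⟨a', b', fun h => hab ?_⟩
      rw [← ha', ← hb', ← map_mul, ← map_mul, h]
    · exact coverAux_normalClause_of_finite_ker π hπc hπs hfin hclause
  exact ⟨H, inferInstance, inferInstance, inferInstance, inferInstance, inferInstance, inferInstance, π, hH,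
    hsc, hπc, hπs, coverAux_le_center_of_finite π.ker hfin, hfin, coverAux_ker_ne_bot π hπc hπs hsc hnsc⟩

end Summit.QuantumFields.YangMills.Theorems.NonSimplyConnectedLatticeGap

end
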